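import Summits.QuantumFields.YangMills.Theorems.BalabanUVNodesN20AtRecord13Co
import Summits.QuantumFields.YangMills.Theorems.BalabanUVNodesSpineCarriersOfRecord12

/-!
# THE SPINE-CARRIER PREDICATE OF RECORD AT NODE 00's RE-BASED CORE-KEYED STAGE-13 RECORD — `YMDAG.UVSplit.SRec₁₃Co cr : SpineRecordPred N`, KEYED FUNCTIONALLY to the admissible Stage-13
# tuples WITH CORE PROVISOS `θ.Provisos₁₃Core F N` and the Co datum `datumOfRecord₁₃Co` of `Node00.IsRecordOfRecord₁₃CCo`, its forms `SRec₁₃CoOn cr Rg` ∕ `SRec₁₃CoU cr`, and the ONE-APPLICATION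
# instances of the five K5 stubs — THE Co EDITION of dag-n20-d's (T-SPINE)₁₃ module 4 `…SpineCarriersOfRecord13` §0–§4 (p490271 ‴; ⁗ p508764), filed for the n20 lineage on dag-lead
# DEDUP-265∕266; namespace `YMDAG.UVSplit` unchanged; definition lane by content (one `abbrev`, three `def`s); the canonical-key sibling `…Keyed` is dag-n19-d's to twin
# (cell `pub-ymgap`, HUMAN RULING D-0062 Track A, R134 seat `pub-ymgap-dag-n27-c` (s2) gen 7; `--kind proof --supports <K3 id of record> --as helper`; COUNT-NEUTRAL; restate-immune)

WHY THIS EDITION (director-ym №152 (β): print's background is the minimiser over [6]'s class (1.7) ∧ (1.9), `UbgMSCoOfRecord` (node00-def-R FILE 22 p512668); node00-def-T KEY-RULE-21: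
RECORD 13 re-based on it in `Node00/Record13Co.lean` — `UbgOfRecord₁₃Co`, `towerOfRecord₁₃Co ∕ datumOfRecord₁₃Co` keyed on the UNCHANGED background-free `θ.Provisos₁₃Core F N`, record
`IsRecordOfRecord₁₃CCo` (same clause order as `…C ∕ …CSep`), shadow `shadow₅OfRecord₁₃Co`, faces `…_stage13Co…`; the item editions ‴ `Provisos₁₃` ∕ ⁗ `Provisos₁₃Sep` ∕ `SepMixed` (asides) ∕
⁵ v1.4 `Provisos₁₃SepCo` (`Node00/Record13SepCo.lean`, `datumOfRecord₁₃SepCo θ h := datumOfRecord₁₃Co θ h.toCore`, `rfl`); plan CORE-YES l.17420, dag-n22-e DESIGN-INPUT-CORE l.17415, RR-2 CORE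
l.17476, dag-lead DEDUP-265∕266 one-declarer-by-lineage).  This module is bg-BLIND and proviso-FIELD-blind: the provisos enter ONLY as the binder type `hc : θ.Provisos₁₃Core F N` and inside
`datumOfRecord₁₃Co F N θ hc`, so it is keyed ONCE — a consumer at any item edition's tuple `(θ, h : θ.Provisos₁₃SepCo F N)` applies it at `hc := h.toCore`, datum by `rfl`; only the
item-facing composer leaf (module XXXVII-class) is re-typed per edition.  Statements AND proofs = the ‴ module's, token for token under KEY-RULE-21 (R1 `₁₃C ↦ ₁₃CCo`, R2 `…₁₃ ↦ …₁₃Co`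
on the datum ∕ tower ∕ shadow tokens, R3 `_stage13 ↦ _stage13Co`, provisos `Provisos₁₃ ↦ Provisos₁₃Core`) + RR-2's AFTER-C key names + the carriers' stems; my stems `…rec13C… ↦ …rec13CCo…`,
`keyed₁₃ ↦ keyed₁₃Co`, `homes₁₃ ↦ homes₁₃Co`, `…₁₃On ↦ …₁₃CoOn`.

THE DEFINITION.  A READING of spine carriers off NODE 00's Stage-13 tuples is a function
`cr : (F : T4Family) → (θ : Node00.Stage13Params F N) → θ.Provisos₁₃Core F N → (ℕ → ℝ) → List (ULoop F) → SpineCarriers` (`SpineReading₁₃Co N`; READINGS TAKE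
THE PROVISOS — objects of record such as `Node00.towerOfRecord₁₃Co θ hP` need them); the predicate it KEYS is
`SRec₁₃Co cr F D g₀ os S :↔ ∃ θ hP, θ.Admissible F N ∧ D = Node00.datumOfRecord₁₃Co F N θ hP ∧ S = cr F θ hP g₀ os`.
The reading is a PARAMETER of this file: NO reading of Bałaban's (1.72)∕(2.18) DRESSED two-run history expansion off the record exists today (dag-n20-e
LOCATED (F1)–(F4); the F3 level-0 start re-keyed at ₁₃ is `Node00/DressedSlotsOfRecord13.lean`, this seat's module 6).  `sRec₁₃Co_congr` is the re-key tool.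
LAYER A at ₁₃ (RR-2's `Node00.SpineAssignment₁₃`) and THE CANONICAL (datum-keyed) face over RR-2's `Node00.canon₁₃Co` live in the sibling module
`BalabanUVNodesSpineCarriersOfRecord13Keyed` (the 400-line rule; it waits on `Node00/Record13DatumKeyCo.lean`); the REGIME-RESTRICTED keys are §4 here, the
guard-keyed instance `SRec₁₃CoU` now reading the rev-16 K3 GUARD BUNDLE `θ.ZtUnity F N ∧ θ.SlotsNondegenerate₁₃ F N` (= RR-2's `unityNondeg₁₃ N F θ`).

WHAT THIS MODULE PROVES (all [bookkeeping]; the ₁₂ file's §0–§4 with `12 ↦ 13`).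
* §1 FACES: `sRec₁₃Co_iff` (`Iff.rfl`) · `sRec₁₃Co_self` · `exists_stage13_of_sRec₁₃Co` · `sRec₁₃Co_image_iff` · `exists_sRec₁₃Co_of_isRecordOfRecord₁₃CCo` · `sRec₁₃Co_congr` ·
  `exists_pinned_sRec₁₃Co_of_inhabited` ∕ `sRec₁₃Co_empty_of_uninhabited` (the K0 link).
* §2 THE ONE-APPLICATION INSTANCES: `s_N20_sRec₁₃Co_iff` (`N20AtRecord13.s_N20_keyed₁₃Co_iff` at key `Iff.rfl`) · `s_N21_sRec₁₃Co_iff` · `s_N19_sRec₁₃Co_iff` ·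
  `s_U4_sRec₁₃Co_iff` · `s_N27x_sRec₁₃Co_of` (the MONOTONE extraction stub at `Rec := Node00.IsRecordOfRecord₁₃CCo F N`: SUFFICIENT θ-form) ·
  `s_N20_sRec₁₃Co_of_extractionLaws` — binder for binder the K5 hypotheses of the N27 knit at `SRec := SRec₁₃Co cr`.
* §3 HONESTY: `k5_sRec₁₃Co_of_uninhabited` (IF no admissible Stage-13 tuple has provisos — a hypothesis — the four antitone stubs at `SRec₁₃Co cr` are free).
* §4 REGIME-RESTRICTED KEYS: `SRec₁₃CoOn cr Rg` · `sRec₁₃CoOn_iff ∕ _self` · `sRec₁₃Co_of_sRec₁₃CoOn` · `sRec₁₃CoOn_true_iff` · `s_N20_sRec₁₃CoOn_iff` · `k5_sRec₁₃CoOn_of_sRec₁₃Co` ·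
  `s_N27x_sRec₁₃Co_of_sRec₁₃CoOn` · the GUARD-KEYED instance `SRec₁₃CoU cr := SRec₁₃CoOn cr (θ ↦ θ.ZtUnity F N ∧ θ.SlotsNondegenerate₁₃ F N)` with `sRec₁₃CoU_iff` ·
  `s_N20_sRec₁₃CoU_iff` (the shape the rev-16 K3 binder prefix quantifies over, RR-2's map §3.3) · `s_N20_sRec₁₃CoU_of_sRec₁₃Co`.

HONEST FRAMING.  PINS ONLY; nothing of Bałaban's is asserted or instantiated; NE7 ∕ NE7b ∕ NE7c are NOT PRINTED for d = 4 and NOT PROVED; no inhabitant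
of `IsRecordOfRecord₁₃CCo` is claimed (K0 open); N19 ∕ N20 ∕ N21 ∕ N27 are NOT discharged (0∕1 at every record); typed 28∕28, discharged count untouched;
one finite four-torus programme at fixed `ε` — NOT ℝ⁴, NOT infinite volume, NOT OS, NOT a mass gap, NOT Clay.  No decl below carries a cite tag.
-/


open Finset

namespace YMDAG.UVSplit

open Literature.MathematicalPhysics.QuantumFieldTheory.Balaban1983to89
open Literature.MathematicalPhysics.QuantumFieldTheory.Balaban1983to89.T4Continuum
open T4WeightBudget (RelWeightBound)
open T4IndicatorShell (ShellWeightBound)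
open Summit.QuantumFields.BalabanUV.T4Continuum.Spine
open Summit.QuantumFields.BalabanUV.T4Continuum.NE7b.PinnedExtraction (ExtractionLaws)
open Summit.QuantumFields.YangMills.Theorems.N20AtRecord13 (s_N20_keyed₁₃Co_iff s_N20_keyed₁₃Co_of_extractionLaws exists_pinned_keyed₁₃Co_of_inhabited)
open Summit.QuantumFields.YangMills.Theorems.N20AtSpineCarriers (s_N20_of_empty)
open Node00 (Stage13Params datumOfRecord₁₃Co IsRecordOfRecord₁₃CCo)

/-! ## §0 The reading type and the definition -/

/-- **A READING OF SPINE CARRIERS OFF NODE 00's STAGE-13 TUPLES**: for every four-torus family, every Stage-13 parameter tuple `θ` WITH its displayed provisos,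
every bare sequence `g₀` and loop string `os`, ONE term-class carrier bundle (`SpineCarriers` of the cut).  The TYPE only; a reading is a parameter `cr` below. -/
abbrev SpineReading₁₃Co (N : ℕ) [NeZero N] : Type 1 :=
  (F : T4Family) → (θ : Stage13Params F N) → θ.Provisos₁₃Core F N → (ℕ → ℝ) → List (ULoop F) → SpineCarriers

variable {N : ℕ} [NeZero N]

/-- **THE SPINE-CARRIER PREDICATE OF RECORD, STAGE 13, KEYED BY THE READING `cr`** (PINS ONLY): at `(F, D, g₀, os)` it pins exactly the bundles
`cr F θ hP g₀ os` of the ADMISSIBLE Stage-13 tuples `θ` WITH PROVISOS `hP` whose datum of record IS `D` (`D = Node00.datumOfRecord₁₃Co F N θ hP`, the datum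
clause of `Node00.IsRecordOfRecord₁₃CCo`). -/
def SRec₁₃Co (cr : SpineReading₁₃Co N) : SpineRecordPred N :=
  fun F D g₀ os S => ∃ (θ : Stage13Params F N) (hP : θ.Provisos₁₃Core F N), θ.Admissible F N ∧ D = datumOfRecord₁₃Co F N θ hP ∧ S = cr F θ hP g₀ os

variable (cr : SpineReading₁₃Co N)

/-! ## §1 Faces -/

/-- Unfolding (`Iff.rfl`). [bookkeeping] -/
theorem sRec₁₃Co_iff {F : T4Family} (D : Datum F N) (g₀ : ℕ → ℝ) (os : List (ULoop F)) (S : SpineCarriers) :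
    SRec₁₃Co cr F D g₀ os S ↔
      ∃ (θ : Stage13Params F N) (hP : θ.Provisos₁₃Core F N), θ.Admissible F N ∧ D = datumOfRecord₁₃Co F N θ hP ∧ S = cr F θ hP g₀ os :=
  Iff.rfl

/-- **THE READING's BUNDLE IS PINNED AT ITS OWN DATUM**: for an admissible θ with provisos, `SRec₁₃Co cr` pins `cr F θ hP g₀ os` at `datumOfRecord₁₃Co F N θ hP`.
[bookkeeping] -/
theorem sRec₁₃Co_self {F : T4Family} (θ : Stage13Params F N) (hP : θ.Provisos₁₃Core F N) (hθ : θ.Admissible F N) (g₀ : ℕ → ℝ) (os : List (ULoop F)) :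
    SRec₁₃Co cr F (datumOfRecord₁₃Co F N θ hP) g₀ os (cr F θ hP g₀ os) :=
  ⟨θ, hP, hθ, rfl, rfl⟩

/-- **TYPED OVER ₁₃C**: every pinned bundle comes with an admissible Stage-13 tuple with provisos realising the datum, of which it is the reading. [bookkeeping] -/
theorem exists_stage13_of_sRec₁₃Co {F : T4Family} {D : Datum F N} {g₀ : ℕ → ℝ} {os : List (ULoop F)} {S : SpineCarriers}
    (h : SRec₁₃Co cr F D g₀ os S) :
    ∃ (θ : Stage13Params F N) (hP : θ.Provisos₁₃Core F N), θ.Admissible F N ∧ D = datumOfRecord₁₃Co F N θ hP ∧ S = cr F θ hP g₀ os :=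
  h

/-- **THE IMAGE**: a bundle is pinned SOMEWHERE by `SRec₁₃Co cr` iff it is the reading of some admissible Stage-13 tuple with provisos at some `(g₀, os)` — the set
the antitone stubs quantify over (p450743 `s_N20_iff_forall_pinned`). [bookkeeping] -/
theorem sRec₁₃Co_image_iff (S : SpineCarriers) :
    (∃ (F : T4Family) (D : Datum F N) (g₀ : ℕ → ℝ) (os : List (ULoop F)), SRec₁₃Co cr F D g₀ os S) ↔
      ∃ (F : T4Family) (θ : Stage13Params F N) (hP : θ.Provisos₁₃Core F N), θ.Admissible F N ∧
        ∃ (g₀ : ℕ → ℝ) (os : List (ULoop F)), S = cr F θ hP g₀ os := by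
  constructor
  · rintro ⟨F, D, g₀, os, θ, hP, hθ, -, hS⟩
    exact ⟨F, θ, hP, hθ, g₀, os, hS⟩
  · rintro ⟨F, θ, hP, hθ, g₀, os, hS⟩
    exact ⟨F, datumOfRecord₁₃Co F N θ hP, g₀, os, θ, hP, hθ, rfl, hS⟩

/-- **AT A STAGE-13 RECORD PAIR** `(D, w)`: some admissible θ with provisos realises `D` (`Node00.exists_provisos_of_isRecordOfRecord₁₃CCo`) and, for every
`(g₀, os)`, its reading IS PINNED AT `D` — the witness shape the monotone stub `S_N27x` asks (§2 `s_N27x_sRec₁₃Co_of`). [bookkeeping] -/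
theorem exists_sRec₁₃Co_of_isRecordOfRecord₁₃CCo {F : T4Family} {D : Datum F N} {w : DagBinding.WorldP} (hR : IsRecordOfRecord₁₃CCo F N D w) :
    ∃ (θ : Stage13Params F N) (hP : θ.Provisos₁₃Core F N), θ.Admissible F N ∧ D = datumOfRecord₁₃Co F N θ hP ∧
      ∀ (g₀ : ℕ → ℝ) (os : List (ULoop F)), SRec₁₃Co cr F D g₀ os (cr F θ hP g₀ os) := by
  obtain ⟨θ, hP, hθ, hD⟩ := Node00.exists_provisos_of_isRecordOfRecord₁₃CCo hR
  exact ⟨θ, hP, hθ, hD, fun g₀ os => ⟨θ, hP, hθ, hD, rfl⟩⟩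

/-- **THE RE-KEY TOOL**: two readings that AGREE on the admissible tuples with provisos key the same predicate (so when a `Node00/` home names its reading, a
consumer's parametric `cr` is re-keyed by one pointwise equation; values off the admissible tuples are junk nobody reads). [bookkeeping] -/
theorem sRec₁₃Co_congr {cr cr' : SpineReading₁₃Co N}
    (h : ∀ (F : T4Family) (θ : Stage13Params F N) (hP : θ.Provisos₁₃Core F N), θ.Admissible F N → ∀ (g₀ : ℕ → ℝ) (os : List (ULoop F)),
      cr F θ hP g₀ os = cr' F θ hP g₀ os)
    {F : T4Family} (D : Datum F N) (g₀ : ℕ → ℝ) (os : List (ULoop F)) (S : SpineCarriers) :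
    SRec₁₃Co cr F D g₀ os S ↔ SRec₁₃Co cr' F D g₀ os S := by
  constructor
  · rintro ⟨θ, hP, hθ, hD, hS⟩
    exact ⟨θ, hP, hθ, hD, hS.trans (h F θ hP hθ g₀ os)⟩
  · rintro ⟨θ, hP, hθ, hD, hS⟩
    exact ⟨θ, hP, hθ, hD, hS.trans (h F θ hP hθ g₀ os).symm⟩

/-- **K0 LINK, positive side**: under the body of the route's K0 at `N` (`∀ F, ∃ D w, IsRecordOfRecord₁₃CCo F N D w` — an antecedent, neither proved nor assumed
elsewhere) the predicate pins, on every family and for every `(g₀, os)`, a bundle at a Stage-13 datum of record (`N20AtRecord12.exists_pinned_keyed₁₃Co_of_inhabited`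
at key `Iff.rfl`). [bookkeeping] -/
theorem exists_pinned_sRec₁₃Co_of_inhabited (hK0 : ∀ F : T4Family, ∃ (D : Datum F N) (w : DagBinding.WorldP), IsRecordOfRecord₁₃CCo F N D w)
    (F : T4Family) (g₀ : ℕ → ℝ) (os : List (ULoop F)) :
    ∃ (D : Datum F N) (w : DagBinding.WorldP) (S : SpineCarriers), IsRecordOfRecord₁₃CCo F N D w ∧ SRec₁₃Co cr F D g₀ os S :=
  exists_pinned_keyed₁₃Co_of_inhabited cr (SRec₁₃Co cr) (fun _ _ _ _ _ => Iff.rfl) hK0 F g₀ os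

/-- **K0 LINK, negative side**: IF no admissible Stage-13 tuple satisfies its provisos on any family (a hypothesis — Record 13's provisos carry no located
contradiction), `SRec₁₃Co cr` pins NOTHING. [bookkeeping] -/
theorem sRec₁₃Co_empty_of_uninhabited (hempty : ∀ (F : T4Family) (θ : Stage13Params F N), θ.Admissible F N → ¬ θ.Provisos₁₃Core F N)
    (F : T4Family) (D : Datum F N) (g₀ : ℕ → ℝ) (os : List (ULoop F)) (S : SpineCarriers) : ¬ SRec₁₃Co cr F D g₀ os S := by
  rintro ⟨θ, hP, hθ, -, -⟩
  exact hempty F θ hθ hP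

/-! ## §2 The one-application instances of the five K5 stubs at `SRec₁₃Co cr` -/

/-- **N20 (NE7b) AT THE STAGE-13 RECORD**: `S_N20 (SRec₁₃Co cr)` ⟺ «for every family, every admissible Stage-13 θ with provisos, every `g₀`, `os`:
`T4WeightBudget.RelWeightBound` at `cr F θ hP g₀ os`» — `N20AtRecord12.s_N20_keyed₁₃Co_iff` at key `Iff.rfl`. [bookkeeping] -/
theorem s_N20_sRec₁₃Co_iff :
    S_N20 (SRec₁₃Co cr) ↔ ∀ (F : T4Family) (θ : Stage13Params F N) (hP : θ.Provisos₁₃Core F N), θ.Admissible F N →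
      ∀ (g₀ : ℕ → ℝ) (os : List (ULoop F)),
        RelWeightBound (cr F θ hP g₀ os).l₀ (cr F θ hP g₀ os).T (cr F θ hP g₀ os).A (cr F θ hP g₀ os).B (cr F θ hP g₀ os).Bad
          (cr F θ hP g₀ os).W :=
  s_N20_keyed₁₃Co_iff cr (SRec₁₃Co cr) fun _ _ _ _ _ => Iff.rfl

/-- **N21 (NE7c) AT THE STAGE-13 RECORD**: `S_N21 (SRec₁₃Co cr)` ⟺ «for every admissible Stage-13 θ with provisos, every `g₀`, `os`:
`T4IndicatorShell.ShellWeightBound` at `cr F θ hP g₀ os`» (direct; dag-n21-d's ₁₃ closers plug in at `SRec := SRec₁₃Co cr`, `hkey := fun _ _ _ _ _ h => h`).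
[bookkeeping] -/
theorem s_N21_sRec₁₃Co_iff :
    S_N21 (SRec₁₃Co cr) ↔ ∀ (F : T4Family) (θ : Stage13Params F N) (hP : θ.Provisos₁₃Core F N), θ.Admissible F N →
      ∀ (g₀ : ℕ → ℝ) (os : List (ULoop F)),
        ShellWeightBound (cr F θ hP g₀ os).l₀ (cr F θ hP g₀ os).T (cr F θ hP g₀ os).A (cr F θ hP g₀ os).B (cr F θ hP g₀ os).shA
          (cr F θ hP g₀ os).shB (cr F θ hP g₀ os).Wsh := by
  constructor
  · intro h F θ hP hθ g₀ os
    exact h F (datumOfRecord₁₃Co F N θ hP) g₀ os _ (sRec₁₃Co_self cr θ hP hθ g₀ os)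
  · rintro h F D g₀ os S ⟨θ, hP, hθ, -, rfl⟩
    exact h F θ hP hθ g₀ os

/-- **N19 (NE7 proper, the edge «in-edges ⇒ Core») AT THE STAGE-13 RECORD**: `S_N19 (SRec₁₃Co cr) Inputs` ⟺ «for every admissible Stage-13 θ with provisos,
every `g₀`, `os`: K4's conclusion `Inputs` READ AT THE DATUM `datumOfRecord₁₃Co F N θ hP` gives `Spine.NE7.Core` on the shell-free cores of `cr F θ hP g₀ os`».
(A consumer keying spine AND rate carriers takes THE SAME θ in this face and in (T-RATE)'s — θ is not determined by `D`; the canonical key of RR-2's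
`Record13DatumKey` is what fixes it.) [bookkeeping] -/
theorem s_N19_sRec₁₃Co_iff (Inputs : InputsPred N) :
    S_N19 (SRec₁₃Co cr) Inputs ↔ ∀ (F : T4Family) (θ : Stage13Params F N) (hP : θ.Provisos₁₃Core F N), θ.Admissible F N →
      ∀ (g₀ : ℕ → ℝ) (os : List (ULoop F)), Inputs F (datumOfRecord₁₃Co F N θ hP) g₀ os → letI := (cr F θ hP g₀ os).dec
        NE7.Core (cr F θ hP g₀ os).l₀ (cr F θ hP g₀ os).vol (cr F θ hP g₀ os).T (cr F θ hP g₀ os).Bad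
          (fun K t τ => (cr F θ hP g₀ os).A K t τ - (cr F θ hP g₀ os).shA K t τ)
          (fun K t τ => (cr F θ hP g₀ os).B K t τ - (cr F θ hP g₀ os).shB K t τ) (cr F θ hP g₀ os).δ := by
  constructor
  · intro h F θ hP hθ g₀ os hI
    exact h F (datumOfRecord₁₃Co F N θ hP) g₀ os _ (sRec₁₃Co_self cr θ hP hθ g₀ os) hI
  · rintro h F D g₀ os S ⟨θ, hP, hθ, rfl, rfl⟩ hI
    exact h F θ hP hθ g₀ os hI

/-- **U4′ (budget bookkeeping) AT THE STAGE-13 RECORD**: `S_U4 (SRec₁₃Co cr)` ⟺ «for every admissible Stage-13 θ with provisos, every `g₀`, `os`: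
`W + Wsh < 1` and `Summable δ` at `cr F θ hP g₀ os`». [bookkeeping] -/
theorem s_U4_sRec₁₃Co_iff :
    S_U4 (SRec₁₃Co cr) ↔ ∀ (F : T4Family) (θ : Stage13Params F N) (hP : θ.Provisos₁₃Core F N), θ.Admissible F N →
      ∀ (g₀ : ℕ → ℝ) (os : List (ULoop F)), (∀ K, (cr F θ hP g₀ os).W K + (cr F θ hP g₀ os).Wsh K < 1) ∧ Summable (cr F θ hP g₀ os).δ := by
  constructor
  · intro h F θ hP hθ g₀ os
    exact h F (datumOfRecord₁₃Co F N θ hP) g₀ os _ (sRec₁₃Co_self cr θ hP hθ g₀ os)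
  · rintro h F D g₀ os S ⟨θ, hP, hθ, -, rfl⟩
    exact h F θ hP hθ g₀ os

/-- **N27x (the extraction stub, MONOTONE) AT THE STAGE-13 RECORD — SUFFICIENT θ-FORM.**  If for every admissible Stage-13 θ with provisos and every
`(g₀, os)` the reading `S := cr F θ hP g₀ os` has `0 < S.l₀`, `0 < S.vol` and satisfies the dictionary E1∕E2 AT THE STAGE-13 DATUM — its class sums ARE the
dressed partition functions `schemeZ ((datumOfRecord₁₃Co F N θ hP).scheme g₀) os (S.K₀ + K) t` ∕ `(S.K₀ + K + 1)` on `|t| ≤ S.l₀` (so the expansion is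
non-degenerate: `N20AtRecord12.schemeZ_pos_datumOfRecord₁₃Co`) — then `S_N27x (Node00.IsRecordOfRecord₁₃CCo F N) (SRec₁₃Co cr)`: at a record pair pick the θ the
pair certifies (`exists_sRec₁₃Co_of_isRecordOfRecord₁₃CCo`) and its reading, under the trivial small-coupling prefix (`ForSmallCouplings.of_forall`).  θ is NOT
determined by `D`, hence no iff. [bookkeeping] -/
theorem s_N27x_sRec₁₃Co_of
    (h : ∀ (F : T4Family) (θ : Stage13Params F N) (hP : θ.Provisos₁₃Core F N), θ.Admissible F N → ∀ (g₀ : ℕ → ℝ) (os : List (ULoop F)),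
      0 < (cr F θ hP g₀ os).l₀ ∧ 0 < (cr F θ hP g₀ os).vol ∧
        (∀ (K : ℕ) (t : ℝ), |t| ≤ (cr F θ hP g₀ os).l₀ →
          T4GenFunBounds.schemeZ ((datumOfRecord₁₃Co F N θ hP).scheme g₀) os ((cr F θ hP g₀ os).K₀ + K) t =
            ∑ τ ∈ (cr F θ hP g₀ os).T K, (cr F θ hP g₀ os).A K t τ) ∧
        (∀ (K : ℕ) (t : ℝ), |t| ≤ (cr F θ hP g₀ os).l₀ →
          T4GenFunBounds.schemeZ ((datumOfRecord₁₃Co F N θ hP).scheme g₀) os ((cr F θ hP g₀ os).K₀ + K + 1) t =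
            ∑ τ ∈ (cr F θ hP g₀ os).T K, (cr F θ hP g₀ os).B K t τ)) :
    S_N27x (fun F D w => IsRecordOfRecord₁₃CCo F N D w) (SRec₁₃Co cr) := by
  intro F D w hR _ _
  obtain ⟨θ, hP, hθ, hD, hpin⟩ := exists_sRec₁₃Co_of_isRecordOfRecord₁₃CCo cr hR
  subst hD
  refine T4ContinuumYM4Torus.ForSmallCouplings.of_forall fun g₀ os => ?_
  obtain ⟨hl, hv, hE1, hE2⟩ := h F θ hP hθ g₀ os
  exact ⟨cr F θ hP g₀ os, hpin g₀ os, hl, hv, hE1, hE2⟩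

/-- **N20's ONE-APPLICATION CLOSER AT `SRec₁₃Co cr`** (`N20AtRecord12.s_N20_keyed₁₃Co_of_extractionLaws` BY NAME): if at every admissible Stage-13 θ with provisos
the reading carries the two runs' `PinnedExtraction.ExtractionLaws` at its exact carriers, nonnegative weights, quotient totals `≤ W K` in both runs, `W K < 1`
and `Summable W`, then `S_N20 (SRec₁₃Co cr)`. [bookkeeping] -/
theorem s_N20_sRec₁₃Co_of_extractionLaws
    (hrows : ∀ (F : T4Family) (θ : Stage13Params F N) (hP : θ.Provisos₁₃Core F N), θ.Admissible F N → ∀ (g₀ : ℕ → ℝ) (os : List (ULoop F)),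
      ∃ (α α' : Type) (X : ℕ → Finset α) (Badx : ℕ → α → Finset (cr F θ hP g₀ os).ι) (q : ℕ → α → ℝ)
        (X' : ℕ → Finset α') (Badx' : ℕ → α' → Finset (cr F θ hP g₀ os).ι) (q' : ℕ → α' → ℝ),
        ExtractionLaws (cr F θ hP g₀ os).l₀ (cr F θ hP g₀ os).T (cr F θ hP g₀ os).A (cr F θ hP g₀ os).Bad X Badx q ∧
        ExtractionLaws (cr F θ hP g₀ os).l₀ (cr F θ hP g₀ os).T (cr F θ hP g₀ os).B (cr F θ hP g₀ os).Bad X' Badx' q' ∧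
        (∀ (K : ℕ) (t : ℝ), |t| ≤ (cr F θ hP g₀ os).l₀ → ∀ τ, 0 ≤ (cr F θ hP g₀ os).A K t τ) ∧
        (∀ (K : ℕ) (t : ℝ), |t| ≤ (cr F θ hP g₀ os).l₀ → ∀ τ, 0 ≤ (cr F θ hP g₀ os).B K t τ) ∧
        (∀ K, ∑ x ∈ X K, q K x ≤ (cr F θ hP g₀ os).W K) ∧ (∀ K, ∑ x ∈ X' K, q' K x ≤ (cr F θ hP g₀ os).W K) ∧
        (∀ K, (cr F θ hP g₀ os).W K < 1) ∧ Summable (cr F θ hP g₀ os).W) :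
    S_N20 (SRec₁₃Co cr) :=
  s_N20_keyed₁₃Co_of_extractionLaws cr (SRec₁₃Co cr) (fun _ _ _ _ _ h => h) hrows

/-! ## §3 Honesty: the located vacuity of the four antitone stubs at an empty record class -/

/-- **IF THE STAGE-13 RECORD CLASS WERE EMPTY, THE FOUR ANTITONE STUBS AT `SRec₁₃Co cr` WOULD BE FREE.**  If no admissible Stage-13 tuple satisfies its provisos
on any family (the NEGATION of K0's body at `N` — a hypothesis), `SRec₁₃Co cr` pins nothing (§1) and `S_N19`, `S_N20`, `S_N21`, `S_U4` hold with NO estimate.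
The monotone `S_N27x` is NOT covered: it is the existence side. [bookkeeping] -/
theorem k5_sRec₁₃Co_of_uninhabited (Inputs : InputsPred N)
    (hempty : ∀ (F : T4Family) (θ : Stage13Params F N), θ.Admissible F N → ¬ θ.Provisos₁₃Core F N) :
    S_N19 (SRec₁₃Co cr) Inputs ∧ S_N20 (SRec₁₃Co cr) ∧ S_N21 (SRec₁₃Co cr) ∧ S_U4 (SRec₁₃Co cr) :=
  ⟨fun F D g₀ os S hS => absurd hS (sRec₁₃Co_empty_of_uninhabited cr hempty F D g₀ os S),
    s_N20_of_empty (SRec₁₃Co cr) (sRec₁₃Co_empty_of_uninhabited cr hempty),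
    fun F D g₀ os S hS => absurd hS (sRec₁₃Co_empty_of_uninhabited cr hempty F D g₀ os S),
    fun F D g₀ os S hS => absurd hS (sRec₁₃Co_empty_of_uninhabited cr hempty F D g₀ os S)⟩

/-! ## §4 Regime-restricted keys — director-ym LINE №99: print's partition of unity `Stage13Params.ZtUnity` travels as a HYPOTHESIS ON θ in the rev-10 items
K0–K3′ (form (i)); node00-def-RR-2's datum key is unity-AGNOSTIC by design.  A reading keyed on a SUB-CLASS `Rg` of the admissible tuples pins FEWER bundles, so
the four antitone stubs at it are WEAKER obligations (implied by the unrestricted ones) and the monotone `S_N27x` a STRONGER one -/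

section Regime

/-- **THE `Rg`-RESTRICTED SPINE-CARRIER PREDICATE, STAGE 13** (PINS ONLY): as `SRec₁₃Co cr`, but pinning only the readings of the admissible tuples with provisos IN
THE REGIME `Rg F θ` (e.g. `Rg F θ := θ.ZtUnity F N`, print's partition of unity of the residual 𝐓-weight factor). [bookkeeping] -/
def SRec₁₃CoOn (Rg : (F : T4Family) → Stage13Params F N → Prop) : SpineRecordPred N :=
  fun F D g₀ os S => ∃ (θ : Stage13Params F N) (hP : θ.Provisos₁₃Core F N), Rg F θ ∧ θ.Admissible F N ∧ D = datumOfRecord₁₃Co F N θ hP ∧ S = cr F θ hP g₀ os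

variable (Rg : (F : T4Family) → Stage13Params F N → Prop)

/-- Unfolding (`Iff.rfl`). [bookkeeping] -/
theorem sRec₁₃CoOn_iff {F : T4Family} (D : Datum F N) (g₀ : ℕ → ℝ) (os : List (ULoop F)) (S : SpineCarriers) :
    SRec₁₃CoOn cr Rg F D g₀ os S ↔
      ∃ (θ : Stage13Params F N) (hP : θ.Provisos₁₃Core F N), Rg F θ ∧ θ.Admissible F N ∧ D = datumOfRecord₁₃Co F N θ hP ∧ S = cr F θ hP g₀ os :=
  Iff.rfl

/-- In the regime, the reading's bundle is pinned at its own datum. [bookkeeping] -/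
theorem sRec₁₃CoOn_self {F : T4Family} (θ : Stage13Params F N) (hP : θ.Provisos₁₃Core F N) (hRg : Rg F θ) (hθ : θ.Admissible F N) (g₀ : ℕ → ℝ)
    (os : List (ULoop F)) : SRec₁₃CoOn cr Rg F (datumOfRecord₁₃Co F N θ hP) g₀ os (cr F θ hP g₀ os) :=
  ⟨θ, hP, hRg, hθ, rfl, rfl⟩

/-- **THE RESTRICTED PREDICATE PINS A SUB-CLASS** of what `SRec₁₃Co cr` pins. [bookkeeping] -/
theorem sRec₁₃Co_of_sRec₁₃CoOn {F : T4Family} {D : Datum F N} {g₀ : ℕ → ℝ} {os : List (ULoop F)} {S : SpineCarriers}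
    (h : SRec₁₃CoOn cr Rg F D g₀ os S) : SRec₁₃Co cr F D g₀ os S := by
  obtain ⟨θ, hP, -, hθ, hD, hS⟩ := h
  exact ⟨θ, hP, hθ, hD, hS⟩

/-- At the trivial regime the restricted predicate IS `SRec₁₃Co cr`. [bookkeeping] -/
theorem sRec₁₃CoOn_true_iff {F : T4Family} (D : Datum F N) (g₀ : ℕ → ℝ) (os : List (ULoop F)) (S : SpineCarriers) :
    SRec₁₃CoOn cr (fun _ _ => True) F D g₀ os S ↔ SRec₁₃Co cr F D g₀ os S :=
  ⟨fun ⟨θ, hP, _, hθ, hD, hS⟩ => ⟨θ, hP, hθ, hD, hS⟩, fun ⟨θ, hP, hθ, hD, hS⟩ => ⟨θ, hP, trivial, hθ, hD, hS⟩⟩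

/-- **N20 AT THE `Rg`-RESTRICTED KEY**: `S_N20 (SRec₁₃CoOn cr Rg)` ⟺ «for every family, every admissible Stage-13 θ with provisos IN THE REGIME `Rg`, every `g₀`,
`os`: NE7b's `RelWeightBound` at `cr F θ hP g₀ os`». [bookkeeping] -/
theorem s_N20_sRec₁₃CoOn_iff :
    S_N20 (SRec₁₃CoOn cr Rg) ↔ ∀ (F : T4Family) (θ : Stage13Params F N) (hP : θ.Provisos₁₃Core F N), Rg F θ → θ.Admissible F N →
      ∀ (g₀ : ℕ → ℝ) (os : List (ULoop F)),
        RelWeightBound (cr F θ hP g₀ os).l₀ (cr F θ hP g₀ os).T (cr F θ hP g₀ os).A (cr F θ hP g₀ os).B (cr F θ hP g₀ os).Bad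
          (cr F θ hP g₀ os).W := by
  constructor
  · intro h F θ hP hRg hθ g₀ os
    exact h F (datumOfRecord₁₃Co F N θ hP) g₀ os _ (sRec₁₃CoOn_self cr Rg θ hP hRg hθ g₀ os)
  · rintro h F D g₀ os S ⟨θ, hP, hRg, hθ, -, rfl⟩
    exact h F θ hP hRg hθ g₀ os

/-- **THE FOUR ANTITONE STUBS TRANSFER FROM THE UNRESTRICTED KEY TO EVERY RESTRICTED ONE** (sub-class inclusion `sRec₁₃Co_of_sRec₁₃CoOn`): the θ-form over ALL
admissible tuples is the STRONGER hypothesis. [bookkeeping] -/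
theorem k5_sRec₁₃CoOn_of_sRec₁₃Co (Inputs : InputsPred N) :
    (S_N19 (SRec₁₃Co cr) Inputs → S_N19 (SRec₁₃CoOn cr Rg) Inputs) ∧ (S_N20 (SRec₁₃Co cr) → S_N20 (SRec₁₃CoOn cr Rg)) ∧
      (S_N21 (SRec₁₃Co cr) → S_N21 (SRec₁₃CoOn cr Rg)) ∧ (S_U4 (SRec₁₃Co cr) → S_U4 (SRec₁₃CoOn cr Rg)) :=
  ⟨fun h F D g₀ os S hS hI => h F D g₀ os S (sRec₁₃Co_of_sRec₁₃CoOn cr Rg hS) hI,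
    fun h F D g₀ os S hS => h F D g₀ os S (sRec₁₃Co_of_sRec₁₃CoOn cr Rg hS),
    fun h F D g₀ os S hS => h F D g₀ os S (sRec₁₃Co_of_sRec₁₃CoOn cr Rg hS),
    fun h F D g₀ os S hS => h F D g₀ os S (sRec₁₃Co_of_sRec₁₃CoOn cr Rg hS)⟩

/-- **… AND THE MONOTONE `S_N27x` TRANSFERS THE OTHER WAY**: an extraction witness pinned by the restricted predicate is pinned by `SRec₁₃Co cr`. [bookkeeping] -/
theorem s_N27x_sRec₁₃Co_of_sRec₁₃CoOn {Rec : RecordPred N} (h : S_N27x Rec (SRec₁₃CoOn cr Rg)) : S_N27x Rec (SRec₁₃Co cr) :=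
  fun F D w hR hB hEnd => (h F D w hR hB hEnd).mono fun g₀ hg os => by
    obtain ⟨S, hSS, hl₀, hvol, hZA, hZB⟩ := hg os
    exact ⟨S, sRec₁₃Co_of_sRec₁₃CoOn cr Rg hSS, hl₀, hvol, hZA, hZB⟩

/-- **THE UNITY-KEYED SPINE-CARRIER PREDICATE, STAGE 13** (director-ym LINE №99): the readings of the admissible tuples with provisos whose residual 𝐓-weight factor
is print's PARTITION OF UNITY (`Stage13Params.ZtUnity`, [Balaban1988Convergent] (3.16)–(3.20) pp. 268–269 as typed by def-T). [bookkeeping] -/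
def SRec₁₃CoU : SpineRecordPred N :=
  SRec₁₃CoOn cr fun F θ => θ.ZtUnity F N ∧ θ.SlotsNondegenerate₁₃ F N

/-- Unfolding (`Iff.rfl`). [bookkeeping] -/
theorem sRec₁₃CoU_iff {F : T4Family} (D : Datum F N) (g₀ : ℕ → ℝ) (os : List (ULoop F)) (S : SpineCarriers) :
    SRec₁₃CoU cr F D g₀ os S ↔
      ∃ (θ : Stage13Params F N) (hP : θ.Provisos₁₃Core F N), (θ.ZtUnity F N ∧ θ.SlotsNondegenerate₁₃ F N) ∧ θ.Admissible F N ∧ D = datumOfRecord₁₃Co F N θ hP ∧ S = cr F θ hP g₀ os :=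
  Iff.rfl

/-- **N20 AT THE UNITY KEY**: `S_N20 (SRec₁₃CoU cr)` ⟺ «for every admissible Stage-13 θ with provisos AND print's partition of unity, every `g₀`, `os`: NE7b's
`RelWeightBound` at `cr F θ hP g₀ os`» — the shape rev-10's K3′ quantifies over (form (i)); implied by `S_N20 (SRec₁₃Co cr)` (`k5_sRec₁₃CoOn_of_sRec₁₃Co`). [bookkeeping] -/
theorem s_N20_sRec₁₃CoU_iff :
    S_N20 (SRec₁₃CoU cr) ↔ ∀ (F : T4Family) (θ : Stage13Params F N) (hP : θ.Provisos₁₃Core F N), (θ.ZtUnity F N ∧ θ.SlotsNondegenerate₁₃ F N) → θ.Admissible F N →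
      ∀ (g₀ : ℕ → ℝ) (os : List (ULoop F)),
        RelWeightBound (cr F θ hP g₀ os).l₀ (cr F θ hP g₀ os).T (cr F θ hP g₀ os).A (cr F θ hP g₀ os).B (cr F θ hP g₀ os).Bad
          (cr F θ hP g₀ os).W :=
  s_N20_sRec₁₃CoOn_iff cr fun F θ => θ.ZtUnity F N ∧ θ.SlotsNondegenerate₁₃ F N

/-- The unrestricted θ-form gives the unity-keyed one. [bookkeeping] -/
theorem s_N20_sRec₁₃CoU_of_sRec₁₃Co (h : S_N20 (SRec₁₃Co cr)) : S_N20 (SRec₁₃CoU cr) :=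
  (k5_sRec₁₃CoOn_of_sRec₁₃Co cr (fun F θ => θ.ZtUnity F N ∧ θ.SlotsNondegenerate₁₃ F N) fun _ _ _ _ => True).2.1 h

end Regime

end YMDAG.UVSplit
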